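import Summits.QuantumFields.YangMills.Theorems.BalabanUVNodesN12DirectSurjHsurjClosedFormLevels
import HarnessLib

/-!
# BalabanUVNodes ∕ N12 — (P4)′ SUPPORT EDITION IN CLOSED FORM: the threshold `ε` and the sup-norm letter `B` of the right inverse DISPLAYED as explicit expressions in per-height
# BINDER constants (the (δ₂)♯ row letter `C₁ ρ₁`, the curved-block letter `C₂ ρ₂`, the flat blocks `Φ C_Φ`, the flat derivative `Λ♭`, a seminorm `p ≥ ℓ²(op)` with a LOCAL letter `C_p`)
# — NO torus bond count anywhere (U4-partial; lane word dag-n12-c g23 «CLAIM-3 closed-form display edition: GO», 2026-08-29)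

Cell `pub-ymgap` (HUMAN RULINGS D-0062 ∕ D-0149), WIDTH SEAT `pub-ymgap-dag-n12-w6` g9 (node N12 = [B15]; key K1⁹ `stmt-QuantumFields-27364`, `--kind proof --supports … --as helper`;
count-neutral).  THEOREMS ONLY (0 `def`, 0 `instance`, 0 `sorry`).  PRODUCER-SIDE SIBLING of this seat's p690553 `…HsurjUniformB` (whose `∃ ε ∃ B` statement — the socket n12-d's v10.1
p691324 `choose`s over through p690734 — is UNTOUCHED): same proof, with the five per-height `obtain`s turned into BINDERS, `exists_threshold` ∕ `exists_cardSeminorm` replaced by CLOSED FORMS ∕ a LOCAL letter, and the curved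
row LOCALISED to its sharp tower before the row letter is applied.

HONEST SCOPE.  U4-PARTIAL: `εH := min (min ρ₁ ρ₂ ∕ (2(D+1))) (1 ∕ (4(D+1)(C₂+1)(C_p·C_Φ+1)))`, `D = (d−1)·(2(L^k + (L^k−1)/2))`, and `B := β(k+1)(1+Λβ)^{k+1}`, `β = 1+2C_Φ`,
`Λ = Λ♭ + C₁ρ₁C_p + 1` are CLOSED FORMS in the binder constants; `C_p` is asked only on fields supported on `≤ 2d·L^{kd}` bonds (so `p := ℓ²(HS)` gives `C_p = √(2d·L^{kd})`, sequel
`…HullCountClosedForm`) — no `#PBond`.  The binder constants' VALUES (`C₁ ρ₁ C₂ ρ₂ C_Φ Λ♭`, from `…SiteBlockCurvedLocal.exists_rowBound_p` ∕ `exists_curved_siteBlock_local`,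
`…HsurjSupportPrelim.exists_flatBlocks_uniform`, `…HsurjUniformBPrelim.exists_flatDeriv_letter`) remain compactness EXISTENTIALS over the torus's field space (census U4 proper,
uncommissioned); print's volume-free (46) is NOT claimed.

THE TWO LOCALISATIONS (the only proof changes vs p690553 besides the binders): (row) the curved row `i = (j,c)` reads `x` only on its sharp tower, so `‖(DΨ(0)x)_i‖ = ‖(DΨ(0)(x·1_T))_i‖`
with `T := {b₀ | B^j(b₀₋) ∈ {c₋,c₊}}` (`#T ≤ 2d·L^{kd}`, p689329 `card_hullLevel_le`), then `exists_rowBound_p` + the local `C_p` letter; (block) the flat block's output at `y` is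
supported on `{b₀ | B^{n+1}(b₀₋) = y}` (`#≤ d·L^{kd}`), so the local `C_p` letter feeds `exists_curved_siteBlock_local`.

CONTENTS.  ★★★ `exists_rightInverse_letter_support_closedForm` (the level-wise solvability step is `…HsurjClosedFormLevels.exists_levelSolution`; the closed-form `ε` facts and the local
`C_p` letter over ≤ 2 sites are `…SiteBlockCurvedLocal.threshold_closedForm` ∕ `seminorm_le_of_twoSites` — split for the 400-line rule).

HONEST FRAMING.  Bookkeeping by name (this lineage's p685568 ∕ p690553 proof with binders displayed); nothing of Bałaban's asserted or refuted; N12 NOT discharged; K1⁹ NOT closed;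
count-neutral; R4 closes only the conditional finite-`𝕋⁴` rung `BalabanLadder.UV`; no summit statement is proved here and NOT the Yang–Mills mass gap (Clay); nothing continuum ∕ ℝ⁴ ∕ OS.
-/

noncomputable section

open scoped BigOperators Matrix.Norms.L2Operator Topology NNReal
open Filter

namespace Summit.QuantumFields.YangMills.BalabanUVNodes.N12DirectSurjHsurjClosedForm

open Literature.MathematicalPhysics.QuantumFieldTheory.Balaban1983to89
open Node00 B15DeterminingSets
open T4Continuum (T4Family)
open BlockAveragingEMLLinearised (linAvg)
open T4AdjointCovarianceUnitary (lieSU)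
open B14.Eq213DetSet (Bj maxDomT Bj_of_gt)
open B14.Eq213MaximalDomains (side)
open B14.Eq216Concrete (feeds)
open B5Eq118OneStroke (iterBlockOf)
open B15Eq112TorusCover (lift)
open T4AxialGaugeSmallField (boxPlaqs)
open Summit.QuantumFields.YangMills.BalabanUVNodes.N12DirectSurjTriangularSupport (exists_rightInverse_bound_support_of_rankwise)
open Summit.QuantumFields.YangMills.BalabanUVNodes.N12DirectSurjHsurjSupportPrelim
open Summit.QuantumFields.YangMills.BalabanUVNodes.N12DirectSurjBoxGauge (exists_boxGauge)
open Summit.QuantumFields.YangMills.BalabanUVNodes.N12DirectSurjHsurjPrelim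
open Summit.QuantumFields.YangMills.BalabanUVNodes.N12DirectSurjHsurjProxiesPrelim
open Summit.QuantumFields.YangMills.BalabanUVNodes.N12DirectSurjSiteBlockCurvedLocal (seminorm_le_of_twoSites threshold_closedForm)
open Summit.QuantumFields.YangMills.BalabanUVNodes.N12DirectSurjHsurjClosedFormLevels (exists_levelSolution)

section Record

variable {F : T4Family} {N : ℕ} [NeZero N] {K k : ℕ}

set_option maxHeartbeats 400000 in
/-- ★★★ **(P4)′, SUPPORT EDITION, CLOSED FORM.**  Given, per height: a family `Q` (the linearised averages) and a seminorm `p` with a LOCAL letter `p(Y) ≤ C_p‖Y‖` for fields `Y`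
supported on at most `2d·L^{kd}` bonds, tied to the chart ONLY through the displayed letters: the (δ₂)♯ row letter in `p`-form with constants `C₁ ρ₁` (`exists_rowBound_p`'s body —
its producer wants `p ≥ ℓ²(op)` and `Ad`-invariant, e.g. `p = ℓ²(HS)`); the curved-site-block letter with constants `C₂ ρ₂` (`exists_curved_siteBlock_local`'s body); flat site blocks `Φ` with
letter `C_Φ ≥ 1` and their reproduction ∕ support properties (`exists_flatBlocks_uniform`'s body); a flat-derivative letter `Λ♭` (`exists_flatDeriv_letter`'s body).  THEN, with `D := (d−1)·(2(L^k+(L^k−1)/2))` and the CLOSED FORMS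
`ε := min (min ρ₁ ρ₂∕(2(D+1))) (1∕(4(D+1)(C₂+1)(C_pC_Φ+1)))`, `B := (1+2C_Φ)·(k+1)·(1+(Λ♭+C₁ρ₁C_p+1)(1+2C_Φ))^{k+1}`: for every `M₁ ≥ 1`, `Z` with (2.13)'s divisibility, `W`, `U₀` in the fibre
with the guarded proxies and the box plaquette letter AT `ε`, a right inverse `H` of `DΨ_{𝐁_k(Z),W,U₀}(0)` with `‖H v‖ ≤ B‖v‖`, `√(Σ_b ‖H v b‖²) ≤ (√#PBond·B)‖v‖` and `hHsupp″` (texts as in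
p685568 ∕ p690553). [cite: Balaban1985Variational, (83) p.290, (44)-(47) p.285, (153) p.301; Balaban1988Convergent, (2.2) p.255, (2.10)-(2.13) pp.256-257; Balaban1987RG1, (0.4) p.253] -/
theorem exists_rightInverse_letter_support_closedForm (hkK : k + 1 ≤ (F.P K).m + (F.P K).K)
    -- the linearised averages `Q` (any family; only the letters below are used)
    (Q : (i : ℕ) → (PBond (F.P K) 0 → Matrix (Fin N) (Fin N) ℂ) → PBond (F.P K) i → Matrix (Fin N) (Fin N) ℂ)
    -- a seminorm `p` with a LOCAL sup-norm letter `C_p` (fields supported on ≤ 2d·L^{kd} bonds); the letters below tie `p`, `Q` to the chart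
    (p : Seminorm ℝ (PBond (F.P K) 0 → lieSU (Fin N))) {Cp : ℝ} (hCp : 0 ≤ Cp)
    (hpT : ∀ (Y : PBond (F.P K) 0 → lieSU (Fin N)) (S : Finset (PBond (F.P K) 0)), (∀ b, b ∉ S → Y b = 0) →
      S.card ≤ 2 * (F.P K).d * ((F.P K).L ^ (F.P K).d) ^ k → p Y ≤ Cp * ‖Y‖)
    -- the (δ₂)♯ row letter in `p`-form, constants `C₁ ρ₁` (`…SiteBlockCurvedLocal.exists_rowBound_p`)
    {C₁ ρ₁ : ℝ} (hC₁ : 0 ≤ C₁) (hρ₁ : 0 < ρ₁)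
    (hRB :
        ∀ (𝔹 : DetSet (F.P K)) (_ : ∀ j, k < j → 𝔹 j = ∅) (_ : k ≤ (F.P K).m + (F.P K).K) (W : MSField (F.P K) (SU N)) (U₀ : GaugeField (F.P K) 0 (SU N))
          (_ : AgreeOn 𝔹 (avgFamily (avOfRecord F N K) U₀) W) (_ : SmallBelow (avOfRecord F N K) k U₀) (i : Fin (constrCard 𝔹 k))
          (u : GaugeTransf (F.P K) 0 (SU N)) ⦃δ : ℝ⦄ (_ : 0 ≤ δ) (_ : δ < ρ₁)
          (_ : ∀ b₀ : PBond (F.P K) 0,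
            (iterBlockOf (((constrEnum 𝔹 k).symm i).1 : ℕ) b₀.src = ((constrEnum 𝔹 k).symm i).2.1.src ∨
              iterBlockOf (((constrEnum 𝔹 k).symm i).1 : ℕ) b₀.src = ((constrEnum 𝔹 k).symm i).2.1.tgt) →
            (iterBlockOf (((constrEnum 𝔹 k).symm i).1 : ℕ) b₀.tgt = ((constrEnum 𝔹 k).symm i).2.1.src ∨
              iterBlockOf (((constrEnum 𝔹 k).symm i).1 : ℕ) b₀.tgt = ((constrEnum 𝔹 k).symm i).2.1.tgt) →
            ‖((GaugeField.gaugeAct u U₀ b₀ : SU N) : Matrix (Fin N) (Fin N) ℂ) - 1‖ ≤ δ)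
          {Λ₀ : ℝ} (_ : 0 ≤ Λ₀)
          (_ : ∀ Y, ‖fderiv ℝ (msChart F N K k 𝔹 (avgFamily (avOfRecord F N K) (1 : GaugeField (F.P K) 0 (SU N))) (1 : GaugeField (F.P K) 0 (SU N))) 0 Y‖ ≤ Λ₀ * ‖Y‖)
          (X : PBond (F.P K) 0 → lieSU (Fin N)),
          ‖fderiv ℝ (msChart F N K k 𝔹 W U₀) 0 X i‖ ≤ Λ₀ * ‖X‖ + C₁ * δ * p X)
    -- the curved-site-block letter, constants `C₂ ρ₂` (`…SiteBlockCurvedLocal.exists_curved_siteBlock_local`)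
    {C₂ ρ₂ : ℝ} (hC₂ : 0 ≤ C₂) (hρ₂ : 0 < ρ₂)
    (hblk :
        ∀ (𝔹 : DetSet (F.P K)) (_ : ∀ j, k < j → 𝔹 j = ∅) (_ : k ≤ (F.P K).m + (F.P K).K) (W : MSField (F.P K) (SU N)) (U₀ : GaugeField (F.P K) 0 (SU N))
          (_ : AgreeOn 𝔹 (avgFamily (avOfRecord F N K) U₀) W) (_ : SmallBelow (avOfRecord F N K) k U₀)
          {n : ℕ} (hn : n + 1 ≤ k) (y' : Site (F.P K) (n + 1))
          (Φ : (PBond (F.P K) (n + 1) → lieSU (Fin N)) →ₗ[ℝ] (PBond (F.P K) 0 → lieSU (Fin N))) {CΦ : ℝ} (_ : 0 ≤ CΦ)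
          (_ : ∀ (v : PBond (F.P K) (n + 1) → lieSU (Fin N)) (c : PBond (F.P K) (n + 1)), (c.src = y' ∨ c.tgt = y') →
            Q (n + 1) (fun b => (Φ v b : Matrix (Fin N) (Fin N) ℂ)) c = (v c : Matrix (Fin N) (Fin N) ℂ))
          (_ : ∀ v, ‖Φ v‖ ≤ CΦ * ‖v‖)
          {Cp : ℝ} (_ : 0 ≤ Cp) (_ : ∀ v, p (Φ v) ≤ Cp * ‖Φ v‖)
          (u : GaugeTransf (F.P K) 0 (SU N)) ⦃δ : ℝ⦄ (_ : 0 ≤ δ) (_ : δ < ρ₂) (_ : C₂ * δ * (Cp * CΦ) ≤ 1 / 2)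
          (_ : ∀ c : PBond (F.P K) (n + 1), (c.src = y' ∨ c.tgt = y') → ∀ b₀ : PBond (F.P K) 0,
            (iterBlockOf (n + 1) b₀.src = c.src ∨ iterBlockOf (n + 1) b₀.src = c.tgt) →
            (iterBlockOf (n + 1) b₀.tgt = c.src ∨ iterBlockOf (n + 1) b₀.tgt = c.tgt) →
            ‖((GaugeField.gaugeAct u U₀ b₀ : SU N) : Matrix (Fin N) (Fin N) ℂ) - 1‖ ≤ δ),
        ∀ t : PBond (F.P K) (n + 1) → lieSU (Fin N),
          ∃ X : PBond (F.P K) 0 → lieSU (Fin N),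
            (∀ (c : PBond (F.P K) (n + 1)) (hc : c ∈ bondsOf (𝔹 (n + 1))), (c.src = y' ∨ c.tgt = y') →
              fderiv ℝ (msChart F N K k 𝔹 W U₀) 0 X (constrEnum 𝔹 k ⟨⟨n + 1, Nat.lt_succ_of_le hn⟩, c, hc⟩) = t c) ∧
            (∀ b : PBond (F.P K) 0, X b ≠ 0 → ∃ v, Φ v b ≠ 0) ∧
            ‖X‖ ≤ 2 * CΦ * ‖t‖)
    -- the flat site blocks and their letter `C_Φ` (`…HsurjSupportPrelim.exists_flatBlocks_uniform`)
    (Φf : (n : ℕ) → Site (F.P K) (n + 1) → ((PBond (F.P K) (n + 1) → lieSU (Fin N)) →ₗ[ℝ] (PBond (F.P K) 0 → lieSU (Fin N)))) {CΦ : ℝ} (hCΦ1 : 1 ≤ CΦ)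
    (hCΦfn : ∀ (n : ℕ), n < k → ∀ (y : Site (F.P K) (n + 1)) v, ‖Φf n y v‖ ≤ CΦ * ‖v‖)
    (hΦprops : ∀ (n : ℕ) (y : Site (F.P K) (n + 1)), n + 1 ≤ (F.P K).m + (F.P K).K →
        (∀ (v : PBond (F.P K) (n + 1) → lieSU (Fin N)) (c : PBond (F.P K) (n + 1)), (c.src = y ∨ c.tgt = y) →
            Q (n + 1) (fun b => (Φf n y v b : Matrix (Fin N) (Fin N) ℂ)) c = (v c : Matrix (Fin N) (Fin N) ℂ)) ∧
        (∀ v (b : PBond (F.P K) 0), Φf n y v b ≠ 0 → iterBlockOf (n + 1) b.src = y ∧ iterBlockOf (n + 1) b.tgt = y ∧ iterBlockOf n b.src ≠ iterBlockOf n b.tgt))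
    -- the flat-derivative letter `Λ♭` (`…HsurjUniformBPrelim.exists_flatDeriv_letter`)
    {Λf : ℝ} (hΛf0 : 0 ≤ Λf)
    (hΛf : ∀ (𝔹 : DetSet (F.P K)) (X : PBond (F.P K) 0 → lieSU (Fin N)),
      ‖fderiv ℝ (msChart F N K k 𝔹 (avgFamily (avOfRecord F N K) (1 : GaugeField (F.P K) 0 (SU N))) (1 : GaugeField (F.P K) 0 (SU N))) 0 X‖ ≤ Λf * ‖X‖) :
    ∀ (M₁ : ℕ) (_ : 1 ≤ M₁) (Z : Set (Site (F.P K) 0)) (_ : side (F.P K).L M₁ k ∣ (F.P K).sitesPerDir 0)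
      (W : MSField (F.P K) (SU N)) (U₀ : GaugeField (F.P K) 0 (SU N)),
        AgreeOn (Bj M₁ Z k) (avgFamily (avOfRecord F N K) U₀) W →
        (∀ i : Fin (constrCard (Bj M₁ Z k) k), ∃ U' : GaugeField (F.P K) 0 (SU N),
          (∀ b ∈ feeds (((constrEnum (Bj M₁ Z k) k).symm i).1 : ℕ) ((constrEnum (Bj M₁ Z k) k).symm i).2.1, U' b = U₀ b) ∧ SmallBelow (avOfRecord F N K) k U') →
        (∀ (j : ℕ), 1 ≤ j → j ≤ k → ∀ y : Site (F.P K) j, embIter j y ∈ maxDomT M₁ Z j → ∃ U' : GaugeField (F.P K) 0 (SU N),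
          (∀ c : PBond (F.P K) j, (c.src = y ∨ c.tgt = y) → ∀ b₀ : PBond (F.P K) 0,
            (iterBlockOf j b₀.src = c.src ∨ iterBlockOf j b₀.src = c.tgt) → (iterBlockOf j b₀.tgt = c.src ∨ iterBlockOf j b₀.tgt = c.tgt) → U' b₀ = U₀ b₀) ∧
          SmallBelow (avOfRecord F N K) k U') →
        (∀ (j : ℕ), 1 ≤ j → j ≤ k → ∀ y : Site (F.P K) j, embIter j y ∈ maxDomT M₁ Z j →
          PlaqSmallOn (boxPlaqs (P := F.P K) (j := 0)
            (fun κ => lift (F.P K) (embIter j y) κ - ((((F.P K).L ^ j : ℕ) : ℤ) + ((((F.P K).L ^ j - 1) / 2 : ℕ) : ℤ)))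
            (fun κ => lift (F.P K) (embIter j y) κ + ((((F.P K).L ^ j : ℕ) : ℤ) + ((((F.P K).L ^ j - 1) / 2 : ℕ) : ℤ))))
            (min (min ρ₁ ρ₂ / (2 * (((((F.P K).d - 1 : ℕ) : ℝ) * ((2 * ((F.P K).L ^ k + ((F.P K).L ^ k - 1) / 2) : ℕ) : ℝ)) + 1))) (1 / (4 * (((((F.P K).d - 1 : ℕ) : ℝ) * ((2 * ((F.P K).L ^ k + ((F.P K).L ^ k - 1) / 2) : ℕ) : ℝ)) + 1) * (C₂ + 1) * (Cp * CΦ + 1)))) U₀) →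
        ∃ H : (Fin (constrCard (Bj M₁ Z k) k) → lieSU (Fin N)) → PBond (F.P K) 0 → lieSU (Fin N),
          (∀ v, fderiv ℝ (msChart F N K k (Bj M₁ Z k) W U₀) 0 (H v) = v) ∧
          (∀ v, ‖H v‖ ≤ ((1 + 2 * CΦ) * ((k + 1 : ℕ) : ℝ) * (1 + (Λf + C₁ * ρ₁ * Cp + 1) * (1 + 2 * CΦ)) ^ (k + 1)) * ‖v‖) ∧
          (∀ v, Real.sqrt (∑ b, ‖H v b‖ ^ 2) ≤ (Real.sqrt (Fintype.card (PBond (F.P K) 0)) * ((1 + 2 * CΦ) * ((k + 1 : ℕ) : ℝ) * (1 + (Λf + C₁ * ρ₁ * Cp + 1) * (1 + 2 * CΦ)) ^ (k + 1))) * ‖v‖) ∧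
          ∀ (v : Fin (constrCard (Bj M₁ Z k) k) → lieSU (Fin N)) (𝒮 : ℕ → Set (PBond (F.P K) 0)),
            (∀ (b : PBond (F.P K) 0) (hb : b ∈ bondsOf (Bj M₁ Z k 0)), v (constrEnum (Bj M₁ Z k) k ⟨⟨0, Nat.succ_pos k⟩, b, hb⟩) ≠ 0 → b ∈ 𝒮 0) →
            (∀ (j : ℕ) (hj : 1 ≤ j) (hjk : j ≤ k) (c : PBond (F.P K) j) (hc : c ∈ bondsOf (Bj M₁ Z k j)),
              (v (constrEnum (Bj M₁ Z k) k ⟨⟨j, Nat.lt_succ_of_le hjk⟩, c, hc⟩) ≠ 0 ∨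
                ∃ m, m < j ∧ ∃ b₀ ∈ 𝒮 m, (iterBlockOf j b₀.src = c.src ∨ iterBlockOf j b₀.src = c.tgt) ∧ (iterBlockOf j b₀.tgt = c.src ∨ iterBlockOf j b₀.tgt = c.tgt)) →
              ∀ y : Site (F.P K) j, (c.src = y ∨ c.tgt = y) → embIter j y ∈ maxDomT M₁ Z j →
              ∀ b₀ : PBond (F.P K) 0, iterBlockOf j b₀.src = y → iterBlockOf j b₀.tgt = y → iterBlockOf (j - 1) b₀.src ≠ iterBlockOf (j - 1) b₀.tgt → b₀ ∈ 𝒮 j) →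
            ∀ b, (∀ m, b ∉ 𝒮 m) → H v b = 0 := by
  classical
  have hk : k ≤ (F.P K).m + (F.P K).K := Nat.le_of_succ_le hkK
  have hCΦ0 : 0 ≤ CΦ := zero_le_one.trans hCΦ1
  set D : ℝ := (((F.P K).d - 1 : ℕ) : ℝ) * ((2 * ((F.P K).L ^ k + ((F.P K).L ^ k - 1) / 2) : ℕ) : ℝ) with hD_def
  have hD0 : 0 ≤ D := mul_nonneg (Nat.cast_nonneg _) (Nat.cast_nonneg _)
  have hDj : ∀ j ≤ k, (((F.P K).d - 1 : ℕ) : ℝ) * ((2 * ((F.P K).L ^ j + ((F.P K).L ^ j - 1) / 2) : ℕ) : ℝ) ≤ D := fun j hj => by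
    rw [hD_def]
    refine mul_le_mul_of_nonneg_left ?_ (Nat.cast_nonneg _)
    have h1 : (F.P K).L ^ j ≤ (F.P K).L ^ k := Nat.pow_le_pow_right (F.P K).L_pos hj
    have h2 : ((F.P K).L ^ j - 1) / 2 ≤ ((F.P K).L ^ k - 1) / 2 := Nat.div_le_div_right (by omega)
    exact_mod_cast (by omega : 2 * ((F.P K).L ^ j + ((F.P K).L ^ j - 1) / 2) ≤ 2 * ((F.P K).L ^ k + ((F.P K).L ^ k - 1) / 2))
  set ρ : ℝ := min ρ₁ ρ₂ with hρ_def
  have hρ : 0 < ρ := lt_min hρ₁ hρ₂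
  set ε : ℝ := min (ρ / (2 * (D + 1))) (1 / (4 * (D + 1) * (C₂ + 1) * (Cp * CΦ + 1))) with hε_def
  obtain ⟨hε, hDε, hDεC⟩ : 0 < ε ∧ D * ε < ρ ∧ C₂ * (D * ε) * (Cp * CΦ) ≤ 1 / 2 := threshold_closedForm hC₂ hCp hCΦ0 hρ hD0
  -- the per-height letters: row bound `Λ`, block letter `β`, and `B`
  set Λ : ℝ := Λf + C₁ * ρ₁ * Cp + 1 with hΛ_def
  have hΛ1 : 1 ≤ Λ := by rw [hΛ_def]; nlinarith [mul_nonneg (mul_nonneg hC₁ hρ₁.le) hCp]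
  have hΛ0 : 0 ≤ Λ := zero_le_one.trans hΛ1
  set β : ℝ := 1 + 2 * CΦ with hβ_def
  have hβ0 : 0 ≤ β := by rw [hβ_def]; linarith
  have hβ1 : 1 ≤ β := by rw [hβ_def]; linarith
  set Nr : ℕ := k + 1 with hNr_def
  intro M₁ hM1 Z hdiv W U₀ hU hprox hproxSite hplaq
  have h𝔹 : ∀ j, k < j → Bj M₁ Z k j = ∅ := fun j hj => Bj_of_gt hj
  -- the LOCAL `p`-letters: fields sourced in the `j`-blocks over at most two `j`-sites (`j ≤ k`) live on `≤ 2d·L^{kd}` bonds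
  have hpS : ∀ (j : ℕ) (_ : j ≤ k) (S : Finset (Site (F.P K) j)) (_ : S.card ≤ 2) (Y : PBond (F.P K) 0 → lieSU (Fin N)),
      (∀ b, Y b ≠ 0 → iterBlockOf j b.src ∈ S) → p Y ≤ Cp * ‖Y‖ := fun j hj S hS Y hY => seminorm_le_of_twoSites hk hpT j hj S hS Y hY
  -- (1) per instance: inner sites, hosts; ranks = LEVELS; towers and columns
  let inner : (j : ℕ) → Site (F.P K) j → Prop := fun j y => embIter j y ∈ maxDomT M₁ Z j
  have hhost := fun j => exists_host (inner j) (fun _ : Site (F.P K) j => (0 : ℕ))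
  choose hostF hostF_mem hostF_inner _hostF_max using hhost
  let host : (j : ℕ) → PBond (F.P K) j → Site (F.P K) j := fun j c => hostF j c.src c.tgt
  have host_mem : ∀ j (c : PBond (F.P K) j), host j c = c.src ∨ host j c = c.tgt := fun j c => hostF_mem j c.src c.tgt
  have host_inner : ∀ j (c : PBond (F.P K) j), (inner j c.src ∨ inner j c.tgt) → inner j (host j c) := fun j c h => hostF_inner j c.src c.tgt h
  have host_touch : ∀ j (c : PBond (F.P K) j), c.src = host j c ∨ c.tgt = host j c := fun j c =>
    (host_mem j c).elim (fun h => Or.inl h.symm) (fun h => Or.inr h.symm)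
  obtain ⟨rank, hrank⟩ : ∃ rank : Fin (constrCard (Bj M₁ Z k) k) → ℕ, ∀ (j' : ℕ) (hj' : j' < k + 1) (c' : PBond (F.P K) j') (hc' : c' ∈ bondsOf (Bj M₁ Z k j')),
      rank (constrEnum (Bj M₁ Z k) k ⟨⟨j', hj'⟩, c', hc'⟩) = j' :=
    ⟨fun i => (((constrEnum (Bj M₁ Z k) k).symm i).1 : ℕ), fun j' hj' c' hc' => by simp only [Equiv.symm_apply_apply]⟩
  let tw : ConstrSet (Bj M₁ Z k) k → Set (PBond (F.P K) 0) := fun s =>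
    if ((s.1 : ℕ)) = 0 then {b₀ | (⟨(s.1 : ℕ), s.2.1⟩ : (j : ℕ) × PBond (F.P K) j) = ⟨0, b₀⟩} else
      {b₀ | (iterBlockOf (s.1 : ℕ) b₀.src = s.2.1.src ∨ iterBlockOf (s.1 : ℕ) b₀.src = s.2.1.tgt) ∧
        (iterBlockOf (s.1 : ℕ) b₀.tgt = s.2.1.src ∨ iterBlockOf (s.1 : ℕ) b₀.tgt = s.2.1.tgt)}
  let cl : ConstrSet (Bj M₁ Z k) k → Set (PBond (F.P K) 0) := fun s =>
    if ((s.1 : ℕ)) = 0 then {b₀ | (⟨(s.1 : ℕ), s.2.1⟩ : (j : ℕ) × PBond (F.P K) j) = ⟨0, b₀⟩} else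
      {b₀ | iterBlockOf (s.1 : ℕ) b₀.src = host s.1 s.2.1 ∧ iterBlockOf (s.1 : ℕ) b₀.tgt = host s.1 s.2.1 ∧
        iterBlockOf ((s.1 : ℕ) - 1) b₀.src ≠ iterBlockOf ((s.1 : ℕ) - 1) b₀.tgt}
  obtain ⟨tower, htower⟩ : ∃ tower : Fin (constrCard (Bj M₁ Z k) k) → Set (PBond (F.P K) 0), ∀ (j' : ℕ) (hj' : j' < k + 1) (c' : PBond (F.P K) j')
      (hc' : c' ∈ bondsOf (Bj M₁ Z k j')), tower (constrEnum (Bj M₁ Z k) k ⟨⟨j', hj'⟩, c', hc'⟩) = if j' = 0 then {b₀ | (⟨j', c'⟩ : (j : ℕ) × PBond (F.P K) j) = ⟨0, b₀⟩} else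
        {b₀ | (iterBlockOf j' b₀.src = c'.src ∨ iterBlockOf j' b₀.src = c'.tgt) ∧ (iterBlockOf j' b₀.tgt = c'.src ∨ iterBlockOf j' b₀.tgt = c'.tgt)} :=
    ⟨fun i => tw ((constrEnum (Bj M₁ Z k) k).symm i), fun j' hj' c' hc' => congrArg tw ((constrEnum (Bj M₁ Z k) k).symm_apply_apply ⟨⟨j', hj'⟩, c', hc'⟩)⟩
  obtain ⟨col, hcol⟩ : ∃ col : Fin (constrCard (Bj M₁ Z k) k) → Set (PBond (F.P K) 0), ∀ (j' : ℕ) (hj' : j' < k + 1) (c' : PBond (F.P K) j')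
      (hc' : c' ∈ bondsOf (Bj M₁ Z k j')), col (constrEnum (Bj M₁ Z k) k ⟨⟨j', hj'⟩, c', hc'⟩) = if j' = 0 then {b₀ | (⟨j', c'⟩ : (j : ℕ) × PBond (F.P K) j) = ⟨0, b₀⟩} else
        {b₀ | iterBlockOf j' b₀.src = host j' c' ∧ iterBlockOf j' b₀.tgt = host j' c' ∧ iterBlockOf (j' - 1) b₀.src ≠ iterBlockOf (j' - 1) b₀.tgt} :=
    ⟨fun i => cl ((constrEnum (Bj M₁ Z k) k).symm i), fun j' hj' c' hc' => congrArg cl ((constrEnum (Bj M₁ Z k) k).symm_apply_apply ⟨⟨j', hj'⟩, c', hc'⟩)⟩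
  have hΨ : DifferentiableAt ℝ (msChart F N K k (Bj M₁ Z k) W U₀) 0 := differentiableAt_msChart_of_towerProxies hk hU hprox
  -- (2) the box gauge at an inner site; the linear map `L = DΨ(0)`, its uniform row bound `Λ`, its row locality
  have hgauge : ∀ (j : ℕ), 1 ≤ j → j ≤ k → ∀ y : Site (F.P K) j, inner j y →
      ∃ u : GaugeTransf (F.P K) 0 (SU N), ∀ (c : PBond (F.P K) j), (c.src = y ∨ c.tgt = y) → ∀ b₀ : PBond (F.P K) 0,
        (iterBlockOf j b₀.src = c.src ∨ iterBlockOf j b₀.src = c.tgt) → (iterBlockOf j b₀.tgt = c.src ∨ iterBlockOf j b₀.tgt = c.tgt) →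
        ‖((GaugeField.gaugeAct u U₀ b₀ : SU N) : Matrix (Fin N) (Fin N) ℂ) - 1‖ ≤ D * ε := by
    intro j hj1 hjk y hy
    obtain ⟨u, hu⟩ := exists_boxGauge (P := F.P K) (N := N) (hjk.trans hk) (three_mul_pow_lt_sitesPerDir hkK hjk) y U₀ hε.le (hplaq j hj1 hjk y hy)
    exact ⟨u, fun c hc b₀ hs ht => (hu b₀ (near_of_endpoint c hc _ hs) (near_of_endpoint c hc _ ht)).trans
      (mul_le_mul_of_nonneg_right (hDj j hjk) hε.le)⟩
  have hDερ₁ : D * ε < ρ₁ := hDε.trans_le (min_le_left _ _)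
  have hDερ₂ : D * ε < ρ₂ := hDε.trans_le (min_le_right _ _)
  have hDε0 : 0 ≤ D * ε := mul_nonneg hD0 hε.le
  set L : (PBond (F.P K) 0 → lieSU (Fin N)) →ₗ[ℝ] (Fin (constrCard (Bj M₁ Z k) k) → lieSU (Fin N)) :=
    (fderiv ℝ (msChart F N K k (Bj M₁ Z k) W U₀) 0).toLinearMap with hL_def
  have hLapp : ∀ x i, L x i = fderiv ℝ (msChart F N K k (Bj M₁ Z k) W U₀) 0 x i := fun _ _ => rfl
  have hrow : ∀ (s : ConstrSet (Bj M₁ Z k) k) (x : PBond (F.P K) 0 → lieSU (Fin N)),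
      ‖fderiv ℝ (msChart F N K k (Bj M₁ Z k) W U₀) 0 x (constrEnum (Bj M₁ Z k) k s)‖ ≤ Λ * ‖x‖ := by
    rintro ⟨⟨j', hj'⟩, c', hc'⟩ x
    have hj'k : j' ≤ k := Nat.lt_succ_iff.1 hj'
    rcases Nat.eq_zero_or_pos j' with rfl | hpos
    · rw [fderiv_msChart_apply_levelZero hU hΨ c' hc' x]
      exact (norm_le_pi_norm x c').trans (le_mul_of_one_le_left (norm_nonneg _) hΛ1)
    · have hin : inner j' (host j' c') := host_inner j' c' (inner_endpoint_of_mem_bondsOf_Bj hpos hj'k hc')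
      obtain ⟨u, hu⟩ := hgauge j' hpos hj'k (host j' c') hin
      have hcy : c'.src = host j' c' ∨ c'.tgt = host j' c' := host_touch j' c'
      have hflat := hu c' hcy
      -- the guarded proxy at the host site, in its own fibre
      obtain ⟨U', hag, hsb'⟩ := hproxSite j' hpos hj'k (host j' c') hin
      have hflat' : ∀ b₀ : PBond (F.P K) 0, (iterBlockOf j' b₀.src = c'.src ∨ iterBlockOf j' b₀.src = c'.tgt) →
          (iterBlockOf j' b₀.tgt = c'.src ∨ iterBlockOf j' b₀.tgt = c'.tgt) →
          ‖((GaugeField.gaugeAct u U' b₀ : SU N) : Matrix (Fin N) (Fin N) ℂ) - 1‖ ≤ D * ε := fun b₀ hs ht => by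
        have e : GaugeField.gaugeAct u U' b₀ = GaugeField.gaugeAct u U₀ b₀ := by
          show u b₀.src * U' b₀ * (u b₀.tgt)⁻¹ = u b₀.src * U₀ b₀ * (u b₀.tgt)⁻¹
          rw [hag c' hcy b₀ hs ht]
        rw [e]; exact hflat b₀ hs ht
      have h := hRB (Bj M₁ Z k) h𝔹 hk (avgFamily (avOfRecord F N K) U') U' (fun _ _ _ => rfl) hsb' (constrEnum (Bj M₁ Z k) k ⟨⟨j', hj'⟩, c', hc'⟩) u hDε0 hDερ₁
      rw [Equiv.symm_apply_apply] at h
      have htr := fderiv_msChart_apply_eq_of_sharpProxy hk hU hΨ hsb' (constrEnum (Bj M₁ Z k) k ⟨⟨j', hj'⟩, c', hc'⟩)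
        (by rw [Equiv.symm_apply_apply]; exact fun b₀ hs ht => hag c' hcy b₀ hs ht) x
      rw [htr]
      -- localise `x` to the fine bonds sourced in the `j'`-blocks of `c'±` (a superset of the sharp tower of the row)
      let xT : PBond (F.P K) 0 → lieSU (Fin N) := fun b => if iterBlockOf j' b.src ∈ ({c'.src, c'.tgt} : Finset (Site (F.P K) j')) then x b else 0
      have hxT : ∀ b, iterBlockOf j' b.src ∈ ({c'.src, c'.tgt} : Finset (Site (F.P K) j')) → xT b = x b := fun b hb => if_pos hb
      have hxT0 : ∀ b, xT b ≠ 0 → iterBlockOf j' b.src ∈ ({c'.src, c'.tgt} : Finset (Site (F.P K) j')) := fun b hb => by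
        by_contra h; exact hb (if_neg h)
      have hxTn : ‖xT‖ ≤ ‖x‖ := (pi_norm_le_iff_of_nonneg (norm_nonneg x)).2 fun b => by
        by_cases hb : iterBlockOf j' b.src ∈ ({c'.src, c'.tgt} : Finset (Site (F.P K) j'))
        · rw [hxT b hb]; exact norm_le_pi_norm x b
        · rw [show xT b = 0 from if_neg hb, norm_zero]; exact norm_nonneg _
      have hpx : p xT ≤ Cp * ‖xT‖ := hpS j' hj'k {c'.src, c'.tgt} Finset.card_le_two xT hxT0
      have hΨ' : DifferentiableAt ℝ (msChart F N K k (Bj M₁ Z k) (avgFamily (avOfRecord F N K) U') U') 0 := differentiableAt_msChart (fun _ _ _ => rfl) hsb'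
      have hvan := fderiv_msChart_apply_eq_zero_of_vanish_sharp' hk hΨ' (x - xT) (constrEnum (Bj M₁ Z k) k ⟨⟨j', hj'⟩, c', hc'⟩)
      rw [Equiv.symm_apply_apply] at hvan
      have hzero : fderiv ℝ (msChart F N K k (Bj M₁ Z k) (avgFamily (avOfRecord F N K) U') U') 0 (x - xT) (constrEnum (Bj M₁ Z k) k ⟨⟨j', hj'⟩, c', hc'⟩) = 0 :=
        hvan fun b₀ hs _ => by
          have hmem : iterBlockOf j' b₀.src ∈ ({c'.src, c'.tgt} : Finset (Site (F.P K) j')) := by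
            rcases hs with h | h
            · rw [h]; exact Finset.mem_insert_self _ _
            · rw [h]; exact Finset.mem_insert_of_mem (Finset.mem_singleton_self _)
          show x b₀ - xT b₀ = 0
          rw [hxT b₀ hmem, sub_self]
      have heq : fderiv ℝ (msChart F N K k (Bj M₁ Z k) (avgFamily (avOfRecord F N K) U') U') 0 x (constrEnum (Bj M₁ Z k) k ⟨⟨j', hj'⟩, c', hc'⟩)
          = fderiv ℝ (msChart F N K k (Bj M₁ Z k) (avgFamily (avOfRecord F N K) U') U') 0 xT (constrEnum (Bj M₁ Z k) k ⟨⟨j', hj'⟩, c', hc'⟩) := by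
        rw [map_sub, Pi.sub_apply] at hzero
        exact sub_eq_zero.1 hzero
      rw [heq]
      refine (h hflat' hΛf0 (hΛf (Bj M₁ Z k)) xT).trans ?_
      have h1 : C₁ * (D * ε) * p xT ≤ C₁ * ρ₁ * (Cp * ‖x‖) :=
        mul_le_mul (mul_le_mul_of_nonneg_left hDερ₁.le hC₁) (hpx.trans (mul_le_mul_of_nonneg_left hxTn hCp)) (apply_nonneg p _)
          (mul_nonneg hC₁ hρ₁.le)
      have h2 : Λf * ‖xT‖ ≤ Λf * ‖x‖ := mul_le_mul_of_nonneg_left hxTn hΛf0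
      rw [hΛ_def]
      nlinarith [norm_nonneg x, h1, h2]
  have hLbound : ∀ x, ‖L x‖ ≤ Λ * ‖x‖ := fun x =>
    (pi_norm_le_iff_of_nonneg (mul_nonneg hΛ0 (norm_nonneg _))).2 fun i => by
      obtain ⟨s, rfl⟩ := (constrEnum (Bj M₁ Z k) k).surjective i
      rw [hLapp]
      exact hrow s x
  have hNr : ∀ i, rank i < Nr := fun i => by
    obtain ⟨⟨⟨j', hj'⟩, c', hc'⟩, rfl⟩ := (constrEnum (Bj M₁ Z k) k).surjective i
    rw [hrank, hNr_def]
    exact hj'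
  have hloc : ∀ (x : PBond (F.P K) 0 → lieSU (Fin N)) (i : Fin (constrCard (Bj M₁ Z k) k)), (∀ b ∈ tower i, x b = 0) → L x i = 0 := by
    intro x i hx
    obtain ⟨⟨⟨j', hj'⟩, c', hc'⟩, rfl⟩ := (constrEnum (Bj M₁ Z k) k).surjective i
    rw [htower] at hx
    rw [hLapp]
    by_cases h0 : j' = 0
    · subst h0
      rw [if_pos rfl] at hx
      rw [fderiv_msChart_apply_levelZero hU hΨ c' hc' x]
      exact hx c' (by rw [Set.mem_setOf_eq])
    · rw [if_neg h0] at hx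
      have key := fderiv_msChart_apply_eq_zero_of_vanish_sharp' hk hΨ x (constrEnum (Bj M₁ Z k) k ⟨⟨j', hj'⟩, c', hc'⟩)
      rw [Equiv.symm_apply_apply] at key
      exact key fun b₀ hs ht => hx b₀ (by rw [Set.mem_setOf_eq]; exact ⟨hs, ht⟩)
  -- (3) rank-wise (= LEVEL-wise) solvability with column supports; the level's direction is the SUM of the site solutions
  have hsolv : ∀ (r : ℕ) (v : Fin (constrCard (Bj M₁ Z k) k) → lieSU (Fin N)), (∀ i, rank i ≠ r → v i = 0) →
      ∃ x : PBond (F.P K) 0 → lieSU (Fin N), (∀ i, rank i = r → L x i = v i) ∧ (∀ i, rank i < r → L x i = 0) ∧ ‖x‖ ≤ β * ‖v‖ ∧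
        (∀ b, x b ≠ 0 → ∃ i, rank i = r ∧ v i ≠ 0 ∧ b ∈ col i) :=
    exists_levelSolution hk Q p hCp hpT hblk Φf hCΦ1 hCΦfn hΦprops hM1 hdiv hU hΨ hproxSite hDε0 hDερ₂ hDεC hgauge host host_touch host_inner
      rank hrank col hcol
  -- (4) back-substitution with supports, the norm conversion, and the support clause in the record's vocabulary
  obtain ⟨H, hHinv, hHB, hHS⟩ := exists_rightInverse_bound_support_of_rankwise L rank hNr tower col hβ0 hΛ0 hLbound hloc hsolv
  refine ⟨H, fun v => ?_, hHB, fun v => ?_, fun v 𝒮 hzero hpos b hb => ?_⟩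
  · have h := hHinv v
    rwa [hL_def, ContinuousLinearMap.coe_coe] at h
  · refine (sqrt_sum_sq_le (H v)).trans ?_
    rw [mul_assoc]; exact mul_le_mul_of_nonneg_left (hHB v) (Real.sqrt_nonneg _)
  · refine hHS v 𝒮 (fun i hi => ?_) b hb
    obtain ⟨⟨⟨j', hj'⟩, c', hc'⟩, rfl⟩ := (constrEnum (Bj M₁ Z k) k).surjective i
    rw [htower, hrank] at hi
    rw [hcol, hrank]
    by_cases h0 : j' = 0
    · subst h0
      rw [if_pos rfl] at hi
      rw [if_pos rfl]
      intro b₀ hb₀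
      rw [Set.mem_setOf_eq, sigma_mk_zero_eq_iff] at hb₀
      subst hb₀
      rcases hi with hv | ⟨m, hm, _⟩
      · exact hzero c' hc' hv
      · exact absurd hm (Nat.not_lt_zero m)
    · have hj1 : 1 ≤ j' := Nat.one_le_iff_ne_zero.2 h0
      have hj'k : j' ≤ k := Nat.lt_succ_iff.1 hj'
      rw [if_neg h0] at hi
      rw [if_neg h0]
      intro b₀ hb₀
      rw [Set.mem_setOf_eq] at hb₀
      obtain ⟨hs, ht, hface⟩ := hb₀
      have hin : inner j' (host j' c') := host_inner j' c' (inner_endpoint_of_mem_bondsOf_Bj hj1 hj'k hc')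
      have hi' : v (constrEnum (Bj M₁ Z k) k ⟨⟨j', Nat.lt_succ_of_le hj'k⟩, c', hc'⟩) ≠ 0 ∨
          ∃ m, m < j' ∧ ∃ b₁ ∈ 𝒮 m, (iterBlockOf j' b₁.src = c'.src ∨ iterBlockOf j' b₁.src = c'.tgt) ∧ (iterBlockOf j' b₁.tgt = c'.src ∨ iterBlockOf j' b₁.tgt = c'.tgt) := by
        rcases hi with hv | ⟨m, hm, b₁, hb₁S, hb₁t⟩
        · exact Or.inl hv
        · exact Or.inr ⟨m, hm, b₁, hb₁S, by rwa [Set.mem_setOf_eq] at hb₁t⟩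
      exact hpos j' hj1 hj'k c' hc' hi' (host j' c') (host_touch j' c') hin b₀ hs ht hface

end Record

end Summit.QuantumFields.YangMills.BalabanUVNodes.N12DirectSurjHsurjClosedForm

end
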